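import Mathlib
import Summits.NavierStokesRegularity.NavierStokesRegularity.Theorems.TypeICertificateLadderRungReynoldsOneTaoCover
import Literature.Analysis.FluidPDE.NSCriticalClosure
import Literature.Analysis.FluidPDE.NSCriticalClosureHolds
import Literature.Analysis.FluidPDE.NSCriticalClosureTao
import Literature.Analysis.FluidPDE.TsaiLocalEnergyScaling
import Literature.Analysis.FluidPDE.TaoLocalisation
import Literature.Analysis.FluidPDE.SelfSimilar
import Literature.Analysis.FluidPDE.NSBoundedMildAnalytic
import Literature.Analysis.FluidPDE.NSLocalLerayBackwardUniqueness
import Literature.Analysis.FluidPDE.ForcedOseenRepresentationClassical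
import Literature.Analysis.FluidPDE.OseenMildUniqueness
import Literature.Analysis.FluidPDE.NSLerayStrongLocalExistence

/-!
# Exact LOCAL discrete self-similarity of a Leray–Hopf blow-up is excluded (it is already global DSS)

Refuter `ns-dss-ref-1`, brief `pub/ideators/ns-idea-5/BRIEF-DSS-template-K1-vs-QLP.md` (a44b88fd06205a00),
task R3 — vacuity probe of the brief's hypothesis object `LocallyDssTypeIBlowupCollar` (a maximal classical
Leray–Hopf solution from a rapidly decaying datum, `c`-DSS (`c > 1`) about `(T, x₀)` INSIDE a backward
parabolic cylinder `‖x − x₀‖ < R/c`, `T − (R/c)² < t < T`; plus Type I, non-triviality, a collar).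
FINDING (sorry-free, standard axioms): the object is EMPTY. Every slice `u(t,·)`, `0 < t < T`, is
real-analytic on `ℝ³` (`analyticOnNhd_slice_of_classical`, from the tree's PROVED
`lemarieRieusset2016_local_analyticity_holds` + `ae_eq_forced_oseenMild` + `oseenMild_bounded_unique`), so the
identity theorem globalises the local DSS identity in space on the window (`dss_global_of_local`); the `L³`
cube is then constant along window orbits (`lintegral_cube_window_iterate`), every late time is carried into
the Tao sub-slab `[0, T − R²/c³]` where `∫|u|³ ≤ B₀·2E₀`, so `sup_{[0,T)}‖u‖₃ < ∞` and the DISCHARGED criterion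
`hasSmoothExtensionPast_of_eLpNorm_three_bounded_holds` contradicts maximality (`not_exists_locallyDssBlowup`,
`not_exists_locallyDssTypeIBlowupCollar`; no rate, non-triviality or collar used). Consequence: every stake lemma
`H → X` of the brief (R3 (a)–(d)) is vacuous — none should be filed as a hold; the honest decider is the
ASYMPTOTICALLY locally-DSS Type-I blow-up (zoom limit a backward `c`-DSS solution on `ℝ³ × (−∞,0)`,
existence open: Bradshaw–Tsai arXiv:1811.00502 §§3–4). Nothing about NS regularity is proved here. [folklore]
-/

set_option linter.dupNamespace false

noncomputable section

open Set MeasureTheory Metric Filter Function Topology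
open scoped ENNReal NNReal
open Literature.Analysis Literature.Analysis.FluidPDE

namespace Summit.NavierStokesRegularity.NavierStokesRegularity.Theorems.QuarterLawTypeINegative

open Summit.NavierStokesRegularity.NavierStokesRegularity.Theorems.RungReynoldsOne (stub_taoCover)

/-- **Spatial analyticity of the slices** `u(t,·)`, `0 < t < T`, of a classical solution on `ℝ³ × [0,T)`,
Leray–Hopf from a rapidly decaying datum: bounded with finite energy on the Tao sub-slab `[0,(t+T)/2]`, hence
Oseen-mild from `u(s₁)` at a base time `s₁ < t` (`ae_eq_forced_oseenMild`), and identified with the analytic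
Picard solution (`lemarieRieusset2016_local_analyticity_holds`, `oseenMild_bounded_unique`).
[cite: LemarieRieusset2016, Thm. 9.12 (PDF p. 260)] -/
theorem analyticOnNhd_slice_of_classical {ν T : ℝ} (hν : 0 < ν) (hT : 0 < T)
    {u : ℝ → EuclideanSpace ℝ (Fin 3) → EuclideanSpace ℝ (Fin 3)} {p : ℝ → EuclideanSpace ℝ (Fin 3) → ℝ}
    (hcl : IsClassicalNSSolutionOn (Ico 0 T) ν 0 u p) (hLH : IsLerayHopfOn T ν 0 (u 0) u)
    (hdec : HasRapidSpatialDecay (u 0)) {t : ℝ} (ht : t ∈ Ioo 0 T) :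
    AnalyticOnNhd ℝ (u t) univ := by
  obtain ⟨ε, hε, C₀, hC₀, hloc⟩ := lemarieRieusset2016_local_analyticity_holds
  -- Tao sub-slab `[0, T']`, `T' = (t + T)/2`: a uniform bound `B₀`
  set T' : ℝ := (t + T) / 2 with hT'def
  have hT'pos : 0 < T' := by rw [hT'def]; linarith [ht.1, ht.2]
  have hT'lt : T' < T := by rw [hT'def]; linarith [ht.2]
  have htT' : t < T' := by rw [hT'def]; linarith [ht.2]
  obtain ⟨q, hclq, hBq, -, -⟩ := stub_taoCover hν hT hcl hLH hdec (T' := T') ⟨hT'pos, hT'lt⟩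
  obtain ⟨B₀, hB₀0, hB₀⟩ := exists_forall_norm_le_of_hasBoundedSobolevNormsOn hclq hBq
  set Mb : ℝ := B₀ + 1 with hMb
  have hMb0 : 0 < Mb := by rw [hMb]; linarith
  set h : ℝ := ε * ν / Mb ^ 2 with hh
  have hh0 : 0 < h := by positivity
  -- base time `s₁ = t - δ`
  set δ : ℝ := min (t / 2) (h / 2) with hδ
  have hδ0 : 0 < δ := lt_min (by linarith [ht.1]) (by linarith)
  have hδt : δ < t := (min_le_left _ _).trans_lt (by linarith [ht.1])
  have hδh : δ < h := (min_le_right _ _).trans_lt (by linarith)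
  set s₁ : ℝ := t - δ with hs₁
  have hs₁0 : 0 < s₁ := by rw [hs₁]; linarith
  have hs₁T' : s₁ < T' := by rw [hs₁]; linarith
  -- the translate `v τ = u (τ + s₁)` on the closed slab `[0, b]`, `b = T' - s₁`
  set b : ℝ := T' - s₁ with hb
  have hb0 : 0 < b := by rw [hb]; linarith
  have hδb : δ < b := by rw [hb, hs₁]; linarith
  set v : ℝ → EuclideanSpace ℝ (Fin 3) → EuclideanSpace ℝ (Fin 3) := fun τ => u (τ + s₁) with hv
  have hclo : IsClassicalNSSolutionOn (Ioo 0 T) ν 0 u p :=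
    hcl.mono Ioo_subset_Ico_self (uniqueDiffOn_Ioo 0 T)
  have hclv : IsClassicalNSSolutionOn (Icc 0 b) ν 0 v (fun τ => p (τ + s₁)) :=
    hclo.translate_Icc_of_Ioo hs₁0 hb0 (by rw [hb]; linarith)
  have hv0 : v 0 = u s₁ := by simp [hv]
  have hvM : ∀ τ ∈ Icc 0 b, ∀ x, ‖v τ x‖ ≤ Mb := by
    intro τ hτ x
    have hτs : τ + s₁ ∈ Icc 0 T' := ⟨by linarith [hτ.1], by rw [hb] at hτ; linarith [hτ.2]⟩
    exact (hB₀ (τ + s₁) hτs x).trans (by rw [hMb]; linarith)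
  have hvE : ∃ C : ℝ≥0∞, C < ⊤ ∧ ∀ τ ∈ Icc 0 b, ∫⁻ x, ‖v τ x‖ₑ ^ 2 ≤ C := by
    refine ⟨ENNReal.ofReal (2 * VectorCalculus.kineticEnergy (u 0)), ENNReal.ofReal_lt_top, ?_⟩
    intro τ hτ
    have hτs : τ + s₁ ∈ Icc 0 T := ⟨by linarith [hτ.1], by rw [hb] at hτ; linarith [hτ.2]⟩
    exact hLH.lintegral_enorm_sq_le hν.le hτs
  -- Oseen-mild from the datum `v 0` (zero force)
  have hmild : ∀ τ ∈ Ioc 0 b, v τ =ᵐ[volume] fun x =>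
      UnboundedOperators.heatExtension (v 0) (ν * τ) x - oseenDuhamel ν 0 v v τ x := by
    intro τ hτ
    have hg0 : ∀ τ' ∈ Icc 0 b, ∀ y : EuclideanSpace ℝ (Fin 3),
        ‖(0 : ℝ → EuclideanSpace ℝ (Fin 3) → EuclideanSpace ℝ (Fin 3)) τ' y‖ ≤ 0 := by
      intro τ' _ y
      simp
    have h1 := hclv.ae_eq_forced_oseenMild hν hb0 (g := 0) (G := 0) continuous_const hg0
      (fun τ' _ => fun θ _ => by simp) (G₂ := 0) ENNReal.zero_ne_top
      (fun τ' _ => by simp) hvE hMb0 hvM hτ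
    have hF : ∀ x, forceDuhamel ν 0 (0 : ℝ → EuclideanSpace ℝ (Fin 3) → EuclideanSpace ℝ (Fin 3)) τ x = 0 := by
      intro x
      have h2 := norm_forceDuhamel_le (g := (0 : ℝ → EuclideanSpace ℝ (Fin 3) → EuclideanSpace ℝ (Fin 3)))
        (G := 0) hν hτ.1.le
        (fun τ' _ y => by simp) x
      rw [mul_zero] at h2
      exact norm_le_zero_iff.1 h2
    filter_upwards [h1] with x hx
    rw [hx, hF x, add_zero]
  -- the local analytic solution from `v 0`
  have hcontv : ∀ τ ∈ Icc 0 b, Continuous (v τ) := fun τ hτ =>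
    (hclv.contDiff_velocity hτ).continuous
  have ha_meas : AEStronglyMeasurable (v 0) volume :=
    (hcontv 0 ⟨le_rfl, hb0.le⟩).aestronglyMeasurable
  have ha_bd : eLpNorm (v 0) ∞ volume ≤ ENNReal.ofReal Mb := by
    rw [eLpNorm_exponent_top]
    exact eLpNormEssSup_le_of_ae_bound (Eventually.of_forall fun x => hvM 0 ⟨le_rfl, hb0.le⟩ x)
  obtain ⟨vl, hvl_an, hvl_eq, hvl_bd⟩ := hloc hν 0 hMb0 ha_meas ha_bd
  -- the common window `(0, T₂)`, `T₂ = min h b ∋ δ`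
  set T₂ : ℝ := min h b with hT₂
  have hδT₂ : δ < T₂ := lt_min hδh hδb
  have hT₂h : T₂ ≤ 0 + ε * ν / Mb ^ 2 := by rw [zero_add]; exact min_le_left _ _
  have hT₂b : T₂ ≤ b := min_le_right _ _
  set M' : ℝ := max Mb (C₀ * Mb) with hM'
  have hM'0 : 0 ≤ M' := hMb0.le.trans (le_max_left _ _)
  have hum : AEStronglyMeasurable (uncurry v) (volume.restrict (Ioo 0 T₂ ×ˢ univ)) :=
    (hclv.smooth_velocity.continuousOn.mono
      (prod_mono (fun τ hτ => ⟨hτ.1.le, hτ.2.le.trans hT₂b⟩) Subset.rfl)).aestronglyMeasurable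
      (measurableSet_Ioo.prod MeasurableSet.univ)
  have hvm : AEStronglyMeasurable (uncurry vl) (volume.restrict (Ioo 0 T₂ ×ˢ univ)) :=
    (hvl_an.continuousOn.mono (prod_mono (Ioo_subset_Ioo_right hT₂h) Subset.rfl)).aestronglyMeasurable
      (measurableSet_Ioo.prod MeasurableSet.univ)
  have huM : ∀ τ ∈ Ioo 0 T₂, ∀ y, ‖v τ y‖ ≤ M' := fun τ hτ y =>
    (hvM τ ⟨hτ.1.le, hτ.2.le.trans hT₂b⟩ y).trans (le_max_left _ _)
  have hvlM : ∀ τ ∈ Ioo 0 T₂, ∀ y, ‖vl τ y‖ ≤ M' := fun τ hτ y =>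
    (hvl_bd τ ⟨hτ.1, hτ.2.trans_le hT₂h⟩ y).trans (le_max_right _ _)
  have hu : ∀ τ ∈ Ioo 0 T₂, v τ =ᵐ[volume] fun x =>
      UnboundedOperators.heatExtension (v 0) (ν * (τ - 0)) x - oseenDuhamel ν 0 v v τ x := by
    intro τ hτ
    rw [sub_zero]
    exact hmild τ ⟨hτ.1, hτ.2.le.trans hT₂b⟩
  have hv' : ∀ τ ∈ Ioo 0 T₂, vl τ =ᵐ[volume] fun x =>
      UnboundedOperators.heatExtension (v 0) (ν * (τ - 0)) x - oseenDuhamel ν 0 vl vl τ x :=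
    fun τ hτ => Eventually.of_forall fun x => hvl_eq τ ⟨hτ.1, hτ.2.trans_le hT₂h⟩ x
  have heq := oseenMild_bounded_unique
    (U := fun τ x => UnboundedOperators.heatExtension (v 0) (ν * (τ - 0)) x)
    hν hM'0 hum hvm huM hvlM hu hv' δ ⟨hδ0, hδT₂⟩
  have hδwin : δ ∈ Ioo 0 (0 + ε * ν / Mb ^ 2) := ⟨hδ0, hδT₂.trans_le hT₂h⟩
  have hvlδ : AnalyticOnNhd ℝ (vl δ) univ := analyticOnNhd_slice hvl_an hδwin
  have hvδ : v δ = u t := by simp [hv, hs₁]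
  have hut : u t = vl δ := by
    rw [← hvδ]
    exact (Continuous.ae_eq_iff_eq volume (hcontv δ ⟨hδ0.le, hδb.le⟩)
      (continuousOn_univ.1 hvlδ.continuousOn)).1 heq
  rw [hut]
  exact hvlδ

/-- **Local DSS is global DSS (in space) on the time window**, by analyticity of the slices and the
identity theorem. [folklore] -/
theorem dss_global_of_local {ν T : ℝ} (hν : 0 < ν) (hT : 0 < T)
    {u : ℝ → EuclideanSpace ℝ (Fin 3) → EuclideanSpace ℝ (Fin 3)} {p : ℝ → EuclideanSpace ℝ (Fin 3) → ℝ}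
    (hcl : IsClassicalNSSolutionOn (Ico 0 T) ν 0 u p) (hLH : IsLerayHopfOn T ν 0 (u 0) u)
    (hdec : HasRapidSpatialDecay (u 0)) {c R : ℝ} {x₀ : EuclideanSpace ℝ (Fin 3)} (hc : 1 < c) (hR : 0 < R)
    (hRT : R ^ 2 ≤ T)
    (hdss : ∀ s ∈ Ioo (-(R / c) ^ 2) 0, ∀ x : (EuclideanSpace ℝ (Fin 3)), ‖x‖ < R / c →
      u (T + s) (x₀ + x) = c • u (T + c ^ 2 * s) (x₀ + c • x))
    {s : ℝ} (hs : s ∈ Ioo (-(R / c) ^ 2) 0) (x : EuclideanSpace ℝ (Fin 3)) :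
    u (T + s) (x₀ + x) = c • u (T + c ^ 2 * s) (x₀ + c • x) := by
  have hc0 : 0 < c := lt_trans zero_lt_one hc
  have hRc : 0 < R / c := div_pos hR hc0
  have hy1 : 1 < c ^ 2 := by nlinarith
  -- both times lie in `(0, T)`
  have hRc2 : (R / c) ^ 2 < R ^ 2 := by
    rw [div_pow, div_lt_iff₀ (by positivity)]; nlinarith [pow_pos hR 2]
  have ht1 : T + s ∈ Ioo 0 T := ⟨by nlinarith [hs.1, hs.2], by linarith [hs.2]⟩
  have ht2 : T + c ^ 2 * s ∈ Ioo 0 T := by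
    refine ⟨?_, by nlinarith [hs.2]⟩
    have h1 : -(R / c) ^ 2 < s := hs.1
    have h2 : c ^ 2 * (R / c) ^ 2 = R ^ 2 := by rw [div_pow]; field_simp
    nlinarith [h1, h2, pow_pos hc0 2]
  have han1 : AnalyticOnNhd ℝ (u (T + s)) univ := analyticOnNhd_slice_of_classical hν hT hcl hLH hdec ht1
  have han2 : AnalyticOnNhd ℝ (u (T + c ^ 2 * s)) univ :=
    analyticOnNhd_slice_of_classical hν hT hcl hLH hdec ht2
  -- the two analytic maps
  set f : EuclideanSpace ℝ (Fin 3) → EuclideanSpace ℝ (Fin 3) := fun y => u (T + s) (x₀ + y) with hf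
  set g : EuclideanSpace ℝ (Fin 3) → EuclideanSpace ℝ (Fin 3) := fun y => c • u (T + c ^ 2 * s) (x₀ + c • y)
    with hg
  have hfa : AnalyticOnNhd ℝ f univ := fun y _ => by
    have hι : AnalyticAt ℝ (fun z : (EuclideanSpace ℝ (Fin 3)) => x₀ + z) y := by fun_prop
    exact (han1 _ (mem_univ _)).comp hι
  have hga : AnalyticOnNhd ℝ g univ := fun y _ => by
    have hι : AnalyticAt ℝ (fun z : (EuclideanSpace ℝ (Fin 3)) => x₀ + c • z) y := by fun_prop
    have h1 : AnalyticAt ℝ (fun z : (EuclideanSpace ℝ (Fin 3)) => u (T + c ^ 2 * s) (x₀ + c • z)) y :=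
      (han2 _ (mem_univ _)).comp hι
    exact h1.fun_const_smul (c := c)
  have hfg : f =ᶠ[𝓝 (0 : EuclideanSpace ℝ (Fin 3))] g := by
    filter_upwards [Metric.ball_mem_nhds (0 : EuclideanSpace ℝ (Fin 3)) hRc] with y hy
    exact hdss s hs y (mem_ball_zero_iff.1 hy)
  have heq : f = g := AnalyticOnNhd.eq_of_eventuallyEq hfa hga hfg
  exact congrFun heq x

/-- **The `L³` cube is constant along the DSS orbits inside the window**: if
`∫|u(T+s)|³ = ∫|u(T+c²s)|³` for every `s ∈ (−(R/c)², 0)`, then for `σ ∈ (−R², 0)` and every `k`,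
`∫|u(T + σ(c²)⁻ᵏ)|³ = ∫|u(T+σ)|³`. [folklore] -/
theorem lintegral_cube_window_iterate {T c R : ℝ} (hc : 1 < c)
    {u : ℝ → EuclideanSpace ℝ (Fin 3) → EuclideanSpace ℝ (Fin 3)}
    (hstep : ∀ s ∈ Ioo (-(R / c) ^ 2) 0, ∫⁻ x, ‖u (T + s) x‖ₑ ^ 3 = ∫⁻ x, ‖u (T + c ^ 2 * s) x‖ₑ ^ 3)
    {σ : ℝ} (hσ : σ ∈ Ioo (-R ^ 2) 0) (k : ℕ) :
    ∫⁻ x, ‖u (T + σ * (c ^ 2)⁻¹ ^ k) x‖ₑ ^ 3 = ∫⁻ x, ‖u (T + σ) x‖ₑ ^ 3 := by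
  have hc0 : 0 < c := lt_trans zero_lt_one hc
  have hy0 : 0 < c ^ 2 := by positivity
  have hy1 : 1 < c ^ 2 := by nlinarith
  induction k with
  | zero => simp
  | succ k ih =>
      -- `s = σ (c²)⁻¹^(k+1)` lies in the window
      have hq0 : 0 < ((c ^ 2)⁻¹) ^ k := pow_pos (inv_pos.2 hy0) k
      have hq1 : ((c ^ 2)⁻¹) ^ k ≤ 1 := pow_le_one₀ (inv_pos.2 hy0).le (inv_le_one_of_one_le₀ hy1.le)
      have hps : ((c ^ 2)⁻¹) ^ (k + 1) = ((c ^ 2)⁻¹) ^ k * (c ^ 2)⁻¹ := pow_succ _ _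
      have hqpos : 0 < ((c ^ 2)⁻¹) ^ (k + 1) := pow_pos (inv_pos.2 hy0) _
      have hqle : ((c ^ 2)⁻¹) ^ (k + 1) ≤ (c ^ 2)⁻¹ := by
        rw [hps]; exact mul_le_of_le_one_left (inv_pos.2 hy0).le hq1
      have hs : σ * (c ^ 2)⁻¹ ^ (k + 1) ∈ Ioo (-(R / c) ^ 2) 0 := by
        have hRc : (R / c) ^ 2 = R ^ 2 * (c ^ 2)⁻¹ := by rw [div_pow, div_eq_mul_inv]
        constructor
        · rw [hRc]
          have h1 : 0 ≤ (-σ) * ((c ^ 2)⁻¹ - ((c ^ 2)⁻¹) ^ (k + 1)) :=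
            mul_nonneg (by linarith [hσ.2]) (by linarith)
          have h2 : 0 < (σ + R ^ 2) * (c ^ 2)⁻¹ := mul_pos (by linarith [hσ.1]) (inv_pos.2 hy0)
          nlinarith [h1, h2]
        · exact mul_neg_of_neg_of_pos hσ.2 hqpos
      rw [hstep _ hs, hps]
      have : c ^ 2 * (σ * ((c ^ 2)⁻¹ ^ k * (c ^ 2)⁻¹)) = σ * (c ^ 2)⁻¹ ^ k := by
        calc c ^ 2 * (σ * ((c ^ 2)⁻¹ ^ k * (c ^ 2)⁻¹))
            = σ * (c ^ 2)⁻¹ ^ k * (c ^ 2 * (c ^ 2)⁻¹) := by ring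
          _ = σ * (c ^ 2)⁻¹ ^ k := by rw [mul_inv_cancel₀ hy0.ne', mul_one]
      rw [this, ih]

/-- **No locally-DSS Leray–Hopf blow-up exists**: there is NO maximal classical Leray–Hopf solution from a
rapidly decaying datum which is EXACTLY `c`-DSS (`c > 1`) about `(T, x₀)` inside a backward cylinder
`‖x − x₀‖ < R/c`, `T − (R/c)² < t < T` (the minimal hypothesis object; unconditional: the analyticity of
Oseen's scheme and the `L^∞_t L³_x` continuation criterion are both PROVED in the tree). [folklore] -/
theorem not_exists_locallyDssBlowup :
    ¬ ∃ (ν T : ℝ) (u : ℝ → EuclideanSpace ℝ (Fin 3) → EuclideanSpace ℝ (Fin 3))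
        (p : ℝ → EuclideanSpace ℝ (Fin 3) → ℝ), 0 < ν ∧ 0 < T ∧
      IsMaximalSmoothSolution ν 0 u p T ∧ IsLerayHopfOn T ν 0 (u 0) u ∧ HasRapidSpatialDecay (u 0) ∧
      ∃ (c R : ℝ) (x₀ : EuclideanSpace ℝ (Fin 3)), 1 < c ∧ 0 < R ∧ R ^ 2 ≤ T ∧
        ∀ s ∈ Ioo (-(R / c) ^ 2) 0, ∀ x : (EuclideanSpace ℝ (Fin 3)), ‖x‖ < R / c →
          u (T + s) (x₀ + x) = c • u (T + c ^ 2 * s) (x₀ + c • x) := by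
  rintro ⟨ν, T, u, p, hν, hT, hmax, hLH, hdec, c, R, x₀, hc, hR, hRT, hdss⟩
  have hc0 : 0 < c := lt_trans zero_lt_one hc
  have hy1 : 1 < c ^ 2 := by nlinarith
  have hy0 : 0 < c ^ 2 := by positivity
  have hR2 : 0 < R ^ 2 := by positivity
  -- (1) globalise the DSS identity on the window
  have hglob : ∀ s ∈ Ioo (-(R / c) ^ 2) 0, ∀ x : (EuclideanSpace ℝ (Fin 3)),
      u (T + s) (x₀ + x) = c • u (T + c ^ 2 * s) (x₀ + c • x) := fun s hs x =>
    dss_global_of_local hν hT hmax.1 hLH hdec hc hR hRT hdss hs x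
  -- (2) the cube is invariant along one step of the orbit
  have hstep : ∀ s ∈ Ioo (-(R / c) ^ 2) 0,
      ∫⁻ x, ‖u (T + s) x‖ₑ ^ 3 = ∫⁻ x, ‖u (T + c ^ 2 * s) x‖ₑ ^ 3 := by
    intro s hs
    have hc3 : ‖c‖ₑ ^ 3 = ENNReal.ofReal (c ^ 3) := by
      rw [Real.enorm_eq_ofReal_abs, ← ENNReal.ofReal_pow (abs_nonneg c), abs_of_pos hc0]
    calc ∫⁻ x, ‖u (T + s) x‖ₑ ^ 3
          = ∫⁻ x, ‖u (T + s) (x₀ + x)‖ₑ ^ 3 := by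
            rw [lintegral_add_left_eq_self (fun x => ‖u (T + s) x‖ₑ ^ 3) x₀]
      _ = ∫⁻ x, ‖c‖ₑ ^ 3 * ‖u (T + c ^ 2 * s) (x₀ + c • x)‖ₑ ^ 3 :=
            lintegral_congr fun x => by rw [hglob s hs x, enorm_smul, mul_pow]
      _ = ‖c‖ₑ ^ 3 * ∫⁻ x, ‖u (T + c ^ 2 * s) (x₀ + c • x)‖ₑ ^ 3 :=
            lintegral_const_mul' _ _ (by simp)
      _ = ‖c‖ₑ ^ 3 * (ENNReal.ofReal ((c ^ 3)⁻¹) * ∫⁻ y, ‖u (T + c ^ 2 * s) (x₀ + y)‖ₑ ^ 3) := by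
            rw [lintegral_comp_smul_fin3 (fun y => ‖u (T + c ^ 2 * s) (x₀ + y)‖ₑ ^ 3) hc0]
      _ = ∫⁻ y, ‖u (T + c ^ 2 * s) (x₀ + y)‖ₑ ^ 3 := by
            rw [← mul_assoc, hc3, ← ENNReal.ofReal_mul (by positivity),
              mul_inv_cancel₀ (by positivity), ENNReal.ofReal_one, one_mul]
      _ = ∫⁻ y, ‖u (T + c ^ 2 * s) y‖ₑ ^ 3 := by
            rw [lintegral_add_left_eq_self (fun y => ‖u (T + c ^ 2 * s) y‖ₑ ^ 3) x₀]
  -- (3) the Tao sub-slab `[0, T']`, `T' = T - R²/c³`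
  have hc3gt : 1 < c ^ 3 := by nlinarith
  set T' : ℝ := T - R ^ 2 / c ^ 3 with hT'def
  have hRc3 : R ^ 2 / c ^ 3 < R ^ 2 := by
    rw [div_lt_iff₀ (by positivity)]; nlinarith
  have hRc3pos : 0 < R ^ 2 / c ^ 3 := by positivity
  have hT'pos : 0 < T' := by rw [hT'def]; linarith
  have hT'lt : T' < T := by rw [hT'def]; linarith
  obtain ⟨q, hcl, hB, -, -⟩ := stub_taoCover hν hT hmax.1 hLH hdec (T' := T') ⟨hT'pos, hT'lt⟩
  obtain ⟨B₀, hB₀0, hB₀⟩ := exists_forall_norm_le_of_hasBoundedSobolevNormsOn hcl hB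
  set E2 : ℝ≥0∞ := ENNReal.ofReal (2 * VectorCalculus.kineticEnergy (u 0)) with hE2
  set J : ℝ≥0∞ := ENNReal.ofReal B₀ * E2 with hJdef
  have hJtop : J ≠ ⊤ := ENNReal.mul_ne_top ENNReal.ofReal_ne_top ENNReal.ofReal_ne_top
  have hcube : ∀ s ∈ Icc 0 T', ∫⁻ x, ‖u s x‖ₑ ^ 3 ≤ J := by
    intro s hs
    have hsT : s ∈ Icc 0 T := ⟨hs.1, hs.2.trans hT'lt.le⟩
    calc ∫⁻ x, ‖u s x‖ₑ ^ 3 ≤ ∫⁻ x, ENNReal.ofReal B₀ * ‖u s x‖ₑ ^ 2 := by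
          refine lintegral_mono fun x => ?_
          rw [pow_succ', sq]
          refine mul_le_mul_left ?_ _
          rw [← ofReal_norm]
          exact ENNReal.ofReal_le_ofReal (hB₀ s hs x)
      _ = ENNReal.ofReal B₀ * ∫⁻ x, ‖u s x‖ₑ ^ 2 := lintegral_const_mul' _ _ ENNReal.ofReal_ne_top
      _ ≤ J := by rw [hJdef]; exact mul_le_mul_right (hLH.lintegral_enorm_sq_le hν.le hsT) _
  -- (4) the cube bound propagates to all of `[0,T)` along the orbits
  have hall : ∀ t ∈ Ico 0 T, ∫⁻ x, ‖u t x‖ₑ ^ 3 ≤ J := by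
    intro t ht
    by_cases hcase : t ≤ T'
    · exact hcube t ⟨ht.1, hcase⟩
    push Not at hcase
    have hτ : 0 < T - t := by linarith [ht.2]
    set τ : ℝ := T - t with hτdef
    have hτlt : τ < R ^ 2 / c ^ 3 := by rw [hτdef]; rw [hT'def] at hcase; linarith
    -- `x = (R²/c)/τ ≥ 1`
    have hA : 0 < R ^ 2 / c := by positivity
    have hAlt : R ^ 2 / c ^ 3 ≤ R ^ 2 / c := by
      apply div_le_div_of_nonneg_left hR2.le hc0; nlinarith
    have hx1 : 1 ≤ R ^ 2 / c / τ := by rw [le_div_iff₀ hτ]; linarith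
    obtain ⟨n, hn1, hn2⟩ := exists_nat_pow_near hx1 hy1
    set τ₀ : ℝ := (c ^ 2) ^ n * τ with hτ₀def
    have hτ₀le : τ₀ ≤ R ^ 2 / c := by rw [hτ₀def]; rwa [le_div_iff₀ hτ] at hn1
    have hτ₀gt : R ^ 2 / c ^ 3 < τ₀ := by
      have hp : (c ^ 2) ^ (n + 1) = (c ^ 2) ^ n * c ^ 2 := pow_succ _ _
      rw [div_lt_iff₀ hτ, hp] at hn2
      have h1 : R ^ 2 / c = R ^ 2 / c ^ 3 * c ^ 2 := by field_simp
      rw [h1] at hn2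
      have h2 : R ^ 2 / c ^ 3 * c ^ 2 < (c ^ 2) ^ n * τ * c ^ 2 := by linarith [hn2]
      rw [hτ₀def]
      exact lt_of_mul_lt_mul_right h2 hy0.le
    have hτ₀pos : 0 < τ₀ := lt_trans hRc3pos hτ₀gt
    have hRcR : R ^ 2 / c < R ^ 2 := by rw [div_lt_iff₀ hc0]; nlinarith
    have hs0 : T - τ₀ ∈ Icc 0 T' := ⟨by linarith, by rw [hT'def]; linarith⟩
    have hσ : -τ₀ ∈ Ioo (-R ^ 2) 0 := ⟨by linarith, by linarith⟩
    have hiter := lintegral_cube_window_iterate (T := T) hc hstep hσ n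
    have harg : T + -τ₀ * (c ^ 2)⁻¹ ^ n = t := by
      rw [hτ₀def, hτdef, inv_pow]; field_simp; ring
    have harg0 : T + -τ₀ = T - τ₀ := by ring
    rw [harg, harg0] at hiter
    rw [hiter]
    exact hcube _ hs0
  -- (5) hence `sup_{[0,T)} ‖u(t)‖₃ < ∞`, and the `L³` criterion extends `u` past `T`
  have h3 : ∀ t ∈ Ico 0 T, eLpNorm (u t) 3 volume ≤ J ^ (1 / 3 : ℝ) := by
    intro t ht
    rw [eLpNorm_eq_lintegral_rpow_enorm_toReal (by norm_num : (3 : ℝ≥0∞) ≠ 0) (by norm_num),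
      ENNReal.toReal_ofNat]
    refine ENNReal.rpow_le_rpow ?_ (by norm_num)
    refine le_trans (le_of_eq (lintegral_congr fun x => ?_)) (hall t ht)
    rw [← ENNReal.rpow_natCast]; norm_num
  have hsup : (⨆ t ∈ Ico 0 T, eLpNorm (u t) 3 volume) < ⊤ := by
    refine lt_of_le_of_lt (iSup₂_le h3) ?_
    exact ENNReal.rpow_lt_top_of_nonneg (by norm_num) hJtop
  exact hmax.2 (hasSmoothExtensionPast_of_eLpNorm_three_bounded_holds ν T hν hT u p hmax.1 hLH hdec hsup)

/-- **Pointwise form**: no maximal classical Leray–Hopf solution from a rapidly decaying datum is exactly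
`c`-DSS (`c > 1`) about `(T, x₀)` on a backward cylinder `B_{R/c}(x₀) × (T − (R/c)², T)`, `R² ≤ T`. [folklore] -/
theorem not_locallyDss_of_maximal {ν T : ℝ} (hν : 0 < ν) (hT : 0 < T)
    {u : ℝ → EuclideanSpace ℝ (Fin 3) → EuclideanSpace ℝ (Fin 3)} {p : ℝ → EuclideanSpace ℝ (Fin 3) → ℝ}
    (hmax : IsMaximalSmoothSolution ν 0 u p T) (hLH : IsLerayHopfOn T ν 0 (u 0) u)
    (hdec : HasRapidSpatialDecay (u 0)) {c R : ℝ} {x₀ : EuclideanSpace ℝ (Fin 3)} (hc : 1 < c) (hR : 0 < R)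
    (hRT : R ^ 2 ≤ T) :
    ¬ (∀ s ∈ Ioo (-(R / c) ^ 2) 0, ∀ x : (EuclideanSpace ℝ (Fin 3)), ‖x‖ < R / c →
        u (T + s) (x₀ + x) = c • u (T + c ^ 2 * s) (x₀ + c • x)) := fun h =>
  not_exists_locallyDssBlowup ⟨ν, T, u, p, hν, hT, hmax, hLH, hdec, c, R, x₀, hc, hR, hRT, h⟩

/-- **The brief's decider object `LocallyDssTypeIBlowupCollar` is EMPTY** (body verbatim from the ideator's
turnkey `lineH/SuperlogCubeRateFalseOfLocallyDss.lean`: locally DSS, single-scar, velocity-Type-I Leray–Hopf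
blow-up with a regularity collar; the Type-I rate, the non-triviality clause and the collar are not used).
[folklore] -/
theorem not_exists_locallyDssTypeIBlowupCollar :
    ¬ ∃ (ν T : ℝ) (u : ℝ → EuclideanSpace ℝ (Fin 3) → EuclideanSpace ℝ (Fin 3))
        (p : ℝ → EuclideanSpace ℝ (Fin 3) → ℝ), 0 < ν ∧ 0 < T ∧
      IsMaximalSmoothSolution ν 0 u p T ∧ IsLerayHopfOn T ν 0 (u 0) u ∧ HasRapidSpatialDecay (u 0) ∧
      IsTypeIBlowup u T ∧
      ∃ (c R B : ℝ) (x₀ : EuclideanSpace ℝ (Fin 3)), 1 < c ∧ 0 < R ∧ R ^ 2 ≤ T ∧ 0 ≤ B ∧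
        (∀ s ∈ Ioo (-(R / c) ^ 2) 0, ∀ x : (EuclideanSpace ℝ (Fin 3)), ‖x‖ < R / c →
          u (T + s) (x₀ + x) = c • u (T + c ^ 2 * s) (x₀ + c • x)) ∧
        (∃ s ∈ Ioo (-(R / c) ^ 2) 0, ∃ x : (EuclideanSpace ℝ (Fin 3)), ‖x‖ < R / c ∧ u (T + s) (x₀ + x) ≠ 0) ∧
        (∀ t ∈ Ico (T - R ^ 2) T, ∀ x : (EuclideanSpace ℝ (Fin 3)), R / c ≤ ‖x‖ → ‖u t (x₀ + x)‖ ≤ B) := by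
  rintro ⟨ν, T, u, p, hν, hT, hmax, hLH, hdec, -, c, R, -, x₀, hc, hR, hRT, -, hdss, -, -⟩
  exact not_exists_locallyDssBlowup ⟨ν, T, u, p, hν, hT, hmax, hLH, hdec, c, R, x₀, hc, hR, hRT, hdss⟩

end Summit.NavierStokesRegularity.NavierStokesRegularity.Theorems.QuarterLawTypeINegative

end
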